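import Mathlib
import HarnessLib
import Summits.HubbardSuperconductivity.HubbardSuperconductivity.Theorems.KLProgrammeKLRegimeSliceSymbolTorusIncrement

/-!
# Route `KLProgramme` — engine support (route (L2), weighted lines, cure (c-D)): the increment of the counterterm slice symbol between two frames on
# the dual torus — TIME differences of orders 1, 2, 3, each carrying the piece

Cell `gate-hubbard-kl`, seat hubbard-kl-k3c3-p2 (g8), for the ENGINE child stmt-HubbardSuperconductivity-20437 (`stub_engine_step_norms`, WEIGHTED lines at
internal levels; v2 conditional token #19; located risk «(b)-Wt@j≥1», evidence #48 CD-LIMITS).  Companion of `…SliceSymbolTorusIncrement` (sup and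
space differences): inside the three-step window the samples of `ΨΔ` along the time direction are those of `ω ↦ Ψ(ξ′, ω) − Ψ(ξ, ω)` at consecutive
Matsubara frequencies (Literature `HubbardSliceSymbolSmoothMixedXi`: `≤ δ^a·M_a·|ξ′ − ξ|`), at the seam they all vanish:

* **`norm_fwdDiff_three_time_sliceSymbolTorusIncr_le`**, **`…two…`**, **`…one…`** — `‖(Δ_{(1,0)})^a ΨΔ (q)‖ ≤ (2π/β)^a·M_a·P₀` (`Λ′ < π(2M−5)/β`,
  `|e_{K′} − e_K| ≤ P₀`), `M₁ = (32B₂+128B₁+128)c/Λ³`, `M₂ = (64B₃+416B₂+1600B₁+1536)c/Λ⁴`, `M₃ = (128B₄+1216B₃+6912B₂+26112B₁+24576)c/Λ⁵`.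

Everything is proved; no definitions, no named facts. [folklore]

References: G. Benfatto, A. Giuliani, V. Mastropietro, Ann. Henri Poincaré 7 (2006) 809–898, (2.36aa), §3 (3.2)–(3.8); M. Salmhofer, *Renormalization*
(1999), §4.2.5 (4.70)–(4.71).
-/

noncomputable section

namespace Summit.HubbardSuperconductivity.HubbardSuperconductivity.Theorems.TorusFourierL2

set_option linter.dupNamespace false -- summit = problem name (single-conjunct summit), D-0017

open Set Complex Finset Literature.MathematicalPhysics.QuantumLattice Literature.Probability.LatticeModels
open Summit.HubbardSuperconductivity.HubbardSuperconductivity.Theorems.DispersionFlow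
open Summit.HubbardSuperconductivity.HubbardSuperconductivity.Theorems.PerturbedFermiCurve
open scoped Real

section Torus

variable {L M : ℕ} [NeZero L] [NeZero M] {c Λ Λ' β μ : ℝ} {K K' : TrigPolyC4v}

omit [NeZero L] in
/-- **Time differences of the torus increment** (orders `a = 1, 2, 3` at once, as a single statement per order below): inside the three-step window
the samples are those of `ω ↦ Ψ(ξ′, ω) − Ψ(ξ, ω)` at consecutive Matsubara frequencies, at the seam they all vanish. Order three:
`‖(Δ_{(1,0)})³ ΨΔ (q)‖ ≤ (2π/β)³·M₃·P₀` (`Λ′ < π(2M−5)/β`). [cite: BenfattoGiulianiMastropietro2006, §3 (3.2)–(3.8)] -/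
theorem norm_fwdDiff_three_time_sliceSymbolTorusIncr_le (hβ : 0 < β) (hΛ : 0 < Λ) (hΛΛ' : Λ ≤ Λ') (hM : Λ' < π * (2 * M - 5) / β)
    (hc : 0 ≤ c) {B₁ B₂ B₃ B₄ : ℝ} (hB₁ : ∀ x, |deriv salmhoferCutoff x| ≤ B₁) (hB₂ : ∀ x, |deriv (deriv salmhoferCutoff) x| ≤ B₂)
    (hB₃ : ∀ x, |deriv (deriv (deriv salmhoferCutoff)) x| ≤ B₃) (hB₄ : ∀ x, |deriv (deriv (deriv (deriv salmhoferCutoff))) x| ≤ B₄)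
    {P₀ : ℝ} (hv₀ : ∀ p, |frameLevel μ K' p - frameLevel μ K p| ≤ P₀) (q : TorusSite 1 (2 * M) × TorusSite 2 L) :
    ‖((fwdDiff ((fun _ : Fin 1 => (1 : ZMod (2 * M))), (0 : TorusSite 2 L)))^[3]
        (fun q : TorusSite 1 (2 * M) × TorusSite 2 L =>
          sliceSymbolFnXi c 0 Λ Λ' (matsubaraFreq β M ⟨(q.1 0).val, ZMod.val_lt (q.1 0)⟩) (nambuXiCT L μ K' q.2) -
            sliceSymbolFnXi c 0 Λ Λ' (matsubaraFreq β M ⟨(q.1 0).val, ZMod.val_lt (q.1 0)⟩) (nambuXiCT L μ K q.2))) q‖ ≤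
      (2 * π / β) ^ 3 * ((128 * B₄ + 1216 * B₃ + 6912 * B₂ + 26112 * B₁ + 24576) * c / Λ ^ 5 * P₀) := by
  have hB10 : 0 ≤ B₁ := (abs_nonneg _).trans (hB₁ 0)
  have hB20 : 0 ≤ B₂ := (abs_nonneg _).trans (hB₂ 0)
  have hB30 : 0 ≤ B₃ := (abs_nonneg _).trans (hB₃ 0)
  have hB40 : 0 ≤ B₄ := (abs_nonneg _).trans (hB₄ 0)
  have hP0 : 0 ≤ P₀ := (abs_nonneg _).trans (hv₀ 0)
  have hMge : 3 ≤ M := by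
    by_contra hlt3
    have hM2 : (M : ℝ) ≤ 2 := by exact_mod_cast (by omega : M ≤ 2)
    have h1 : Λ' * β < π * (2 * (M : ℝ) - 5) := (lt_div_iff₀ hβ).1 hM
    nlinarith [Real.pi_pos, mul_pos (hΛ.trans_le hΛΛ') hβ]
  rw [fwdDiff_iter_prod_fst]
  set ξ := nambuXiCT L μ K q.2 with hξ
  set ξ' := nambuXiCT L μ K' q.2 with hξ'
  have hy : |ξ' - ξ| ≤ P₀ := by rw [hξ, hξ', nambuXiCT_sub_eq]; exact hv₀ _
  have eξ : ξ' = ξ + (ξ' - ξ) := by ring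
  set u : TorusSite 1 (2 * M) := fun _ => (1 : ZMod (2 * M)) with hu
  set F : TorusSite 1 (2 * M) → ℂ := fun a =>
    sliceSymbolFnXi c 0 Λ Λ' (matsubaraFreq β M ⟨(a 0).val, ZMod.val_lt (a 0)⟩) ξ' -
      sliceSymbolFnXi c 0 Λ Λ' (matsubaraFreq β M ⟨(a 0).val, ZMod.val_lt (a 0)⟩) ξ with hF
  set f : ℝ → ℂ := fun t => sliceSymbolFn c 0 Λ Λ' (ξ + (ξ' - ξ)) t - sliceSymbolFn c 0 Λ Λ' ξ t with hf
  change ‖(fwdDiff u)^[3] F q.1‖ ≤ _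
  by_cases hin : (q.1 0).val + 3 < 2 * M
  · have hs : ∀ k ≤ 3, F (q.1 + k • u) = f (gridFreq M (2 * M) β q.1 + k • (2 * π / β)) := by
      intro k hk
      simp only [hF, hf]
      rw [← sliceSymbolFn_eq_sliceSymbolFnXi, ← sliceSymbolFn_eq_sliceSymbolFnXi, matsubaraFreq_val_eq_gridFreq, hu,
        gridFreq_add_smul β q.1 k (by omega), nsmul_eq_mul, ← eξ]
    rw [fwdDiff_iter_eq_of_samples_eq u (2 * π / β) F f 3 q.1 (gridFreq M (2 * M) β q.1) hs, hf]
    refine (norm_fwdDiff_iter_three_sliceSymbolFn_incr_le hΛ hΛΛ' (abs_zero_le_quarter hΛ) hc hB₁ hB₂ hB₃ hB₄ (by positivity) _).trans ?_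
    exact mul_le_mul_of_nonneg_left (mul_le_mul_of_nonneg_left hy (by positivity)) (by positivity)
  · have hval : ∀ k ≤ 3, ((q.1 + k • u) 0).val ≤ 2 ∨ 2 * M ≤ ((q.1 + k • u) 0).val + 2 + 1 := by
      intro k hk
      have hv : ((q.1 + k • u) 0).val = ((q.1 0).val + k) % (2 * M) := by
        rw [Pi.add_apply, hu, smul_const_one_apply, ZMod.val_add, ZMod.val_natCast, Nat.add_mod_mod]
      rw [hv]
      have hlt := ZMod.val_lt (q.1 0)
      by_cases hwrap : (q.1 0).val + k < 2 * M
      · right; rw [Nat.mod_eq_of_lt hwrap]; omega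
      · left
        have : (q.1 0).val + k - 2 * M < 2 * M := by omega
        rw [show (q.1 0).val + k = ((q.1 0).val + k - 2 * M) + 2 * M by omega, Nat.add_mod_right, Nat.mod_eq_of_lt this]
        omega
    have hs : ∀ k ≤ 3, F (q.1 + k • u) = 0 := by
      intro k hk
      simp only [hF]
      rw [sliceSymbolTorus_eq_zero_of_seam₃ (c := c) hβ hΛ hΛΛ' hM (q.1 + k • u) (hval k hk) ξ',
        sliceSymbolTorus_eq_zero_of_seam₃ (c := c) hβ hΛ hΛΛ' hM (q.1 + k • u) (hval k hk) ξ, sub_zero]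
    rw [fwdDiff_iter_eq_zero_of_samples_eq_zero u F 3 q.1 hs, norm_zero]
    positivity

omit [NeZero L] in
/-- **Time differences of the torus increment, order two**: `‖(Δ_{(1,0)})² ΨΔ (q)‖ ≤ (2π/β)²·M₂·P₀` (`Λ′ < π(2M−5)/β`).
[cite: BenfattoGiulianiMastropietro2006, §3 (3.2)–(3.8)] -/
theorem norm_fwdDiff_two_time_sliceSymbolTorusIncr_le (hβ : 0 < β) (hΛ : 0 < Λ) (hΛΛ' : Λ ≤ Λ') (hM : Λ' < π * (2 * M - 5) / β)
    (hc : 0 ≤ c) {B₁ B₂ B₃ B₄ : ℝ} (hB₁ : ∀ x, |deriv salmhoferCutoff x| ≤ B₁) (hB₂ : ∀ x, |deriv (deriv salmhoferCutoff) x| ≤ B₂)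
    (hB₃ : ∀ x, |deriv (deriv (deriv salmhoferCutoff)) x| ≤ B₃) (hB₄ : ∀ x, |deriv (deriv (deriv (deriv salmhoferCutoff))) x| ≤ B₄)
    {P₀ : ℝ} (hv₀ : ∀ p, |frameLevel μ K' p - frameLevel μ K p| ≤ P₀) (q : TorusSite 1 (2 * M) × TorusSite 2 L) :
    ‖((fwdDiff ((fun _ : Fin 1 => (1 : ZMod (2 * M))), (0 : TorusSite 2 L)))^[2]
        (fun q : TorusSite 1 (2 * M) × TorusSite 2 L =>
          sliceSymbolFnXi c 0 Λ Λ' (matsubaraFreq β M ⟨(q.1 0).val, ZMod.val_lt (q.1 0)⟩) (nambuXiCT L μ K' q.2) -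
            sliceSymbolFnXi c 0 Λ Λ' (matsubaraFreq β M ⟨(q.1 0).val, ZMod.val_lt (q.1 0)⟩) (nambuXiCT L μ K q.2))) q‖ ≤
      (2 * π / β) ^ 2 * ((64 * B₃ + 416 * B₂ + 1600 * B₁ + 1536) * c / Λ ^ 4 * P₀) := by
  have hB10 : 0 ≤ B₁ := (abs_nonneg _).trans (hB₁ 0)
  have hB20 : 0 ≤ B₂ := (abs_nonneg _).trans (hB₂ 0)
  have hB30 : 0 ≤ B₃ := (abs_nonneg _).trans (hB₃ 0)
  have hP0 : 0 ≤ P₀ := (abs_nonneg _).trans (hv₀ 0)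
  have hMge : 3 ≤ M := by
    by_contra hlt3
    have hM2 : (M : ℝ) ≤ 2 := by exact_mod_cast (by omega : M ≤ 2)
    have h1 : Λ' * β < π * (2 * (M : ℝ) - 5) := (lt_div_iff₀ hβ).1 hM
    nlinarith [Real.pi_pos, mul_pos (hΛ.trans_le hΛΛ') hβ]
  rw [fwdDiff_iter_prod_fst]
  set ξ := nambuXiCT L μ K q.2 with hξ
  set ξ' := nambuXiCT L μ K' q.2 with hξ'
  have hy : |ξ' - ξ| ≤ P₀ := by rw [hξ, hξ', nambuXiCT_sub_eq]; exact hv₀ _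
  have eξ : ξ' = ξ + (ξ' - ξ) := by ring
  set u : TorusSite 1 (2 * M) := fun _ => (1 : ZMod (2 * M)) with hu
  set F : TorusSite 1 (2 * M) → ℂ := fun a =>
    sliceSymbolFnXi c 0 Λ Λ' (matsubaraFreq β M ⟨(a 0).val, ZMod.val_lt (a 0)⟩) ξ' -
      sliceSymbolFnXi c 0 Λ Λ' (matsubaraFreq β M ⟨(a 0).val, ZMod.val_lt (a 0)⟩) ξ with hF
  set f : ℝ → ℂ := fun t => sliceSymbolFn c 0 Λ Λ' (ξ + (ξ' - ξ)) t - sliceSymbolFn c 0 Λ Λ' ξ t with hf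
  change ‖(fwdDiff u)^[2] F q.1‖ ≤ _
  by_cases hin : (q.1 0).val + 2 < 2 * M
  · have hs : ∀ k ≤ 2, F (q.1 + k • u) = f (gridFreq M (2 * M) β q.1 + k • (2 * π / β)) := by
      intro k hk
      simp only [hF, hf]
      rw [← sliceSymbolFn_eq_sliceSymbolFnXi, ← sliceSymbolFn_eq_sliceSymbolFnXi, matsubaraFreq_val_eq_gridFreq, hu,
        gridFreq_add_smul β q.1 k (by omega), nsmul_eq_mul, ← eξ]
    rw [fwdDiff_iter_eq_of_samples_eq u (2 * π / β) F f 2 q.1 (gridFreq M (2 * M) β q.1) hs, hf]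
    refine (norm_fwdDiff_iter_two_sliceSymbolFn_incr_le hΛ hΛΛ' (abs_zero_le_quarter hΛ) hc hB₁ hB₂ hB₃ hB₄ (by positivity) _).trans ?_
    exact mul_le_mul_of_nonneg_left (mul_le_mul_of_nonneg_left hy (by positivity)) (by positivity)
  · have hval : ∀ k ≤ 2, ((q.1 + k • u) 0).val ≤ 2 ∨ 2 * M ≤ ((q.1 + k • u) 0).val + 2 + 1 := by
      intro k hk
      have hv : ((q.1 + k • u) 0).val = ((q.1 0).val + k) % (2 * M) := by
        rw [Pi.add_apply, hu, smul_const_one_apply, ZMod.val_add, ZMod.val_natCast, Nat.add_mod_mod]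
      rw [hv]
      have hlt := ZMod.val_lt (q.1 0)
      by_cases hwrap : (q.1 0).val + k < 2 * M
      · right; rw [Nat.mod_eq_of_lt hwrap]; omega
      · left
        have : (q.1 0).val + k - 2 * M < 2 * M := by omega
        rw [show (q.1 0).val + k = ((q.1 0).val + k - 2 * M) + 2 * M by omega, Nat.add_mod_right, Nat.mod_eq_of_lt this]
        omega
    have hs : ∀ k ≤ 2, F (q.1 + k • u) = 0 := by
      intro k hk
      simp only [hF]
      rw [sliceSymbolTorus_eq_zero_of_seam₃ (c := c) hβ hΛ hΛΛ' hM (q.1 + k • u) (hval k hk) ξ',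
        sliceSymbolTorus_eq_zero_of_seam₃ (c := c) hβ hΛ hΛΛ' hM (q.1 + k • u) (hval k hk) ξ, sub_zero]
    rw [fwdDiff_iter_eq_zero_of_samples_eq_zero u F 2 q.1 hs, norm_zero]
    positivity

omit [NeZero L] in
/-- **Time differences of the torus increment, order one**: `‖Δ_{(1,0)} ΨΔ (q)‖ ≤ (2π/β)·M₁·P₀` (`Λ′ < π(2M−5)/β`).
[cite: BenfattoGiulianiMastropietro2006, §3 (3.2)–(3.8)] -/
theorem norm_fwdDiff_one_time_sliceSymbolTorusIncr_le (hβ : 0 < β) (hΛ : 0 < Λ) (hΛΛ' : Λ ≤ Λ') (hM : Λ' < π * (2 * M - 5) / β)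
    (hc : 0 ≤ c) {B₁ B₂ B₃ B₄ : ℝ} (hB₁ : ∀ x, |deriv salmhoferCutoff x| ≤ B₁) (hB₂ : ∀ x, |deriv (deriv salmhoferCutoff) x| ≤ B₂)
    (hB₃ : ∀ x, |deriv (deriv (deriv salmhoferCutoff)) x| ≤ B₃) (hB₄ : ∀ x, |deriv (deriv (deriv (deriv salmhoferCutoff))) x| ≤ B₄)
    {P₀ : ℝ} (hv₀ : ∀ p, |frameLevel μ K' p - frameLevel μ K p| ≤ P₀) (q : TorusSite 1 (2 * M) × TorusSite 2 L) :
    ‖fwdDiff ((fun _ : Fin 1 => (1 : ZMod (2 * M))), (0 : TorusSite 2 L))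
        (fun q : TorusSite 1 (2 * M) × TorusSite 2 L =>
          sliceSymbolFnXi c 0 Λ Λ' (matsubaraFreq β M ⟨(q.1 0).val, ZMod.val_lt (q.1 0)⟩) (nambuXiCT L μ K' q.2) -
            sliceSymbolFnXi c 0 Λ Λ' (matsubaraFreq β M ⟨(q.1 0).val, ZMod.val_lt (q.1 0)⟩) (nambuXiCT L μ K q.2)) q‖ ≤
      (2 * π / β) * ((32 * B₂ + 128 * B₁ + 128) * c / Λ ^ 3 * P₀) := by
  have hB10 : 0 ≤ B₁ := (abs_nonneg _).trans (hB₁ 0)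
  have hB20 : 0 ≤ B₂ := (abs_nonneg _).trans (hB₂ 0)
  have hP0 : 0 ≤ P₀ := (abs_nonneg _).trans (hv₀ 0)
  have hMge : 3 ≤ M := by
    by_contra hlt3
    have hM2 : (M : ℝ) ≤ 2 := by exact_mod_cast (by omega : M ≤ 2)
    have h1 : Λ' * β < π * (2 * (M : ℝ) - 5) := (lt_div_iff₀ hβ).1 hM
    nlinarith [Real.pi_pos, mul_pos (hΛ.trans_le hΛΛ') hβ]
  have h1 := fwdDiff_iter_prod_fst (fun q : TorusSite 1 (2 * M) × TorusSite 2 L =>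
      sliceSymbolFnXi c 0 Λ Λ' (matsubaraFreq β M ⟨(q.1 0).val, ZMod.val_lt (q.1 0)⟩) (nambuXiCT L μ K' q.2) -
        sliceSymbolFnXi c 0 Λ Λ' (matsubaraFreq β M ⟨(q.1 0).val, ZMod.val_lt (q.1 0)⟩) (nambuXiCT L μ K q.2))
    (fun _ : Fin 1 => (1 : ZMod (2 * M))) 1 q
  simp only [Function.iterate_one] at h1
  rw [h1]
  set ξ := nambuXiCT L μ K q.2 with hξ
  set ξ' := nambuXiCT L μ K' q.2 with hξ'
  have hy : |ξ' - ξ| ≤ P₀ := by rw [hξ, hξ', nambuXiCT_sub_eq]; exact hv₀ _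
  have eξ : ξ' = ξ + (ξ' - ξ) := by ring
  set u : TorusSite 1 (2 * M) := fun _ => (1 : ZMod (2 * M)) with hu
  set F : TorusSite 1 (2 * M) → ℂ := fun a =>
    sliceSymbolFnXi c 0 Λ Λ' (matsubaraFreq β M ⟨(a 0).val, ZMod.val_lt (a 0)⟩) ξ' -
      sliceSymbolFnXi c 0 Λ Λ' (matsubaraFreq β M ⟨(a 0).val, ZMod.val_lt (a 0)⟩) ξ with hF
  set f : ℝ → ℂ := fun t => sliceSymbolFn c 0 Λ Λ' (ξ + (ξ' - ξ)) t - sliceSymbolFn c 0 Λ Λ' ξ t with hf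
  change ‖fwdDiff u F q.1‖ ≤ _
  by_cases hin : (q.1 0).val + 1 < 2 * M
  · have hs : ∀ k ≤ 1, F (q.1 + k • u) = f (gridFreq M (2 * M) β q.1 + k • (2 * π / β)) := by
      intro k hk
      simp only [hF, hf]
      rw [← sliceSymbolFn_eq_sliceSymbolFnXi, ← sliceSymbolFn_eq_sliceSymbolFnXi, matsubaraFreq_val_eq_gridFreq, hu,
        gridFreq_add_smul β q.1 k (by omega), nsmul_eq_mul, ← eξ]
    have e1 := fwdDiff_iter_eq_of_samples_eq u (2 * π / β) F f 1 q.1 (gridFreq M (2 * M) β q.1) hs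
    simp only [Function.iterate_one] at e1
    rw [e1, hf]
    refine (norm_fwdDiff_sliceSymbolFn_incr_le hΛ hΛΛ' (abs_zero_le_quarter hΛ) hc hB₁ hB₂ hB₃ hB₄ (by positivity) _).trans ?_
    exact mul_le_mul_of_nonneg_left (mul_le_mul_of_nonneg_left hy (by positivity)) (by positivity)
  · have hval : ∀ k ≤ 1, ((q.1 + k • u) 0).val ≤ 2 ∨ 2 * M ≤ ((q.1 + k • u) 0).val + 2 + 1 := by
      intro k hk
      have hv : ((q.1 + k • u) 0).val = ((q.1 0).val + k) % (2 * M) := by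
        rw [Pi.add_apply, hu, smul_const_one_apply, ZMod.val_add, ZMod.val_natCast, Nat.add_mod_mod]
      rw [hv]
      have hlt := ZMod.val_lt (q.1 0)
      by_cases hwrap : (q.1 0).val + k < 2 * M
      · right; rw [Nat.mod_eq_of_lt hwrap]; omega
      · left
        have : (q.1 0).val + k - 2 * M < 2 * M := by omega
        rw [show (q.1 0).val + k = ((q.1 0).val + k - 2 * M) + 2 * M by omega, Nat.add_mod_right, Nat.mod_eq_of_lt this]
        omega
    have hs : ∀ k ≤ 1, F (q.1 + k • u) = 0 := by
      intro k hk
      simp only [hF]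
      rw [sliceSymbolTorus_eq_zero_of_seam₃ (c := c) hβ hΛ hΛΛ' hM (q.1 + k • u) (hval k hk) ξ',
        sliceSymbolTorus_eq_zero_of_seam₃ (c := c) hβ hΛ hΛΛ' hM (q.1 + k • u) (hval k hk) ξ, sub_zero]
    have e1 := fwdDiff_iter_eq_zero_of_samples_eq_zero u F 1 q.1 hs
    simp only [Function.iterate_one] at e1
    rw [e1, norm_zero]
    positivity

end Torus

end Summit.HubbardSuperconductivity.HubbardSuperconductivity.Theorems.TorusFourierL2

end
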